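import Summits.ValiantsHypothesis.ValiantsHypothesis.Theorems.BarrierLeverPartitionMinorsMooreBenchStage

/-!
# Route BarrierLever — item 20172 (CPM), benchmark row 14: the hierarchical Moore peel, STAGE
# REDUCTION II — recombination by `G_i⁻¹` and the leading coefficients

Helper file (`--supports stmt-ValiantsHypothesis-20172`; cell valiant-natproofs, rung V4, 𝒟-side of
door (c), benchmark «row 14», duty (iv); seat valiant-natproofs-prover gen 14).  Closes NO item;
definition-free.  Source: planner p1 g18, `HOME/p1/g18/MEMO-g18.md` §2.3 (group `S' = ∅`: the
window `[c_i, c_i + i)` and `G_i`; groups `S' = {b}`: the new attached rows `(T_i, {b})`).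

* `peelMatrix_inv_mul_window` — `det G_i ≠ 0` ⇒ over `ℂ`, `Σ_j G_i⁻¹[j', j] · G̃[j, c_i + m] = [j' = m]`.
* **`linearIndependent_reducedRow`** — if the rows alive at stage `(i+1, n)` are linearly independent
  over `A = MvPolynomial (Fin h) ℂ` and `det G_i ≠ 0`, then the reduced rows at stage `(i, n+1)`
  (`reducedRow`, file `…MooreBenchStage`) are linearly independent over `A[X]`: recombining the
  reduced attached rows by `G_i⁻¹` (`linearIndependent_of_block`) gives rows vanishing below degree
  `c_i + j'` with leading coefficient vector `e_{c_i + j'}`; the reduced pair rows vanish below degree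
  `i` with leading coefficient vector `|T_i|! · (T_i, {b})`; the fixed rows are constants — so the
  leading coefficient vectors are, up to units, the rows alive at stage `(i+1, n)`
  (`linearIndependent_of_coeff`).

WHAT THIS IS NOT: Theorem A itself (file `…MooreBenchPeel`); nothing on items 20172 / 20195 / 19717,
crux stmt-ValiantsHypothesis-14610, or `VP` versus `VNP`.
-/

set_option linter.dupNamespace false

namespace Summit.ValiantsHypothesis.ValiantsHypothesis.Theorems.BarrierLever.MoorePeel

open Polynomial Finset

/-- Pulling an independent family back along an injective map into the index set keeps it
independent (subtype version used for `stageRows`). -/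
theorem linearIndependent_comp_subtype {S : Type*} [CommRing S] {M : Type*} [AddCommGroup M]
    [Module S M] {K : Type*} (F' : Finset RowLabel) (v : RowLabel → M) (φ : K → RowLabel)
    (hφ : ∀ x, φ x ∈ F') (hinj : Function.Injective φ)
    (h : LinearIndependent S (fun y : ↥F' => v (y : RowLabel))) :
    LinearIndependent S (fun x : K => v (φ x)) :=
  h.comp (fun x => (⟨φ x, hφ x⟩ : ↥F')) fun _ _ exy => hinj (congrArg Subtype.val exy)


/-- Over `ℂ`, the peel matrix with nonzero integer determinant is invertible; its inverse `G⁻¹`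
satisfies `Σ_j G⁻¹[j', j] · G̃[j, c_i + m] = [j' = m]`. -/
theorem peelMatrix_inv_mul_window (i : ℕ) (hG : (peelMatrix i).det ≠ 0) (j' m : Fin i) :
    ∑ j : Fin i, ((peelMatrix i).map (Int.castRingHom ℂ))⁻¹ j' j *
      (inclFactorial (j : ℕ) (windowStart i + (m : ℕ)) : ℂ) = if j' = m then 1 else 0 := by
  set Gc : Matrix (Fin i) (Fin i) ℂ := (peelMatrix i).map (Int.castRingHom ℂ) with hGc
  have hdet : IsUnit Gc.det := by
    rw [isUnit_iff_ne_zero]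
    intro h0
    apply hG
    have e0 : (Int.castRingHom ℂ) (peelMatrix i).det = 0 := by
      rw [RingHom.map_det, RingHom.mapMatrix_apply, ← hGc]
      exact h0
    rw [eq_intCast] at e0
    exact Int.cast_eq_zero.mp e0
  have hmul : Gc⁻¹ * Gc = 1 := Matrix.nonsing_inv_mul Gc hdet
  have e : ∀ j : Fin i, (inclFactorial (j : ℕ) (windowStart i + (m : ℕ)) : ℂ) = Gc j m := by
    intro j
    rw [hGc, Matrix.map_apply, peelMatrix_eq_inclFactorial]
    simp
  simp_rw [e]
  rw [← Matrix.mul_apply, hmul, Matrix.one_apply]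


/-- **STAGE REDUCTION II.**  If the rows alive at stage `(i+1, n)` are linearly independent over
`MvPolynomial (Fin h) ℂ` and `det G_i ≠ 0`, then the reduced rows at stage `(i, n+1)` are linearly
independent over `(MvPolynomial (Fin h) ℂ)[X]`. -/
theorem linearIndependent_reducedRow (h i n r : ℕ) (hG : (peelMatrix i).det ≠ 0)
    (IH : LinearIndependent (MvPolynomial (Fin h) ℂ)
      (fun y : ↥(stageRows (i + 1) n) => rowVec r (nodeY h) (y : RowLabel))) :
    LinearIndependent (Polynomial (MvPolynomial (Fin h) ℂ))
      (fun x : ↥(stageRows i (n + 1)) => reducedRow r i n (nodeY h) (x : RowLabel)) := by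
  classical
  -- the three kinds of labels alive at stage `(i, n+1)`
  set ι₁ : Fin i → ↥(stageRows i (n + 1)) := fun j =>
    ⟨Sum.inr (Sum.inl ((j : ℕ), n)), inr_inl_mem_stageRows.mpr ⟨j.2, Nat.lt_succ_self n⟩⟩ with hι₁
  set ι₂ : Fin n → ↥(stageRows i (n + 1)) := fun b =>
    ⟨Sum.inr (Sum.inr ((b : ℕ), n)), inr_inr_mem_stageRows.mpr ⟨b.2, Nat.lt_succ_self n⟩⟩ with hι₂
  have hι₁inj : Function.Injective ι₁ := by
    intro j j' e
    have := congrArg Subtype.val e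
    simp only [hι₁, Sum.inr.injEq, Sum.inl.injEq, Prod.mk.injEq] at this
    exact Fin.ext this.1
  have htri : ∀ x : ↥(stageRows i (n + 1)), (x : RowLabel) ∈ stageRows i n ∨
      (∃ j', x = ι₁ j') ∨ (∃ b : Fin n, x = ι₂ b) := by
    rintro ⟨x, hx⟩
    rcases x with m | ⟨j, b⟩ | ⟨b, b'⟩
    · exact Or.inl (inl_mem_stageRows.mpr (inl_mem_stageRows.mp hx))
    · obtain ⟨hj, hb⟩ := inr_inl_mem_stageRows.mp hx
      rcases Nat.lt_succ_iff_lt_or_eq.mp hb with hb | rfl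
      · exact Or.inl (inr_inl_mem_stageRows.mpr ⟨hj, hb⟩)
      · exact Or.inr (Or.inl ⟨⟨j, hj⟩, rfl⟩)
    · obtain ⟨hbb, hb'⟩ := inr_inr_mem_stageRows.mp hx
      rcases Nat.lt_succ_iff_lt_or_eq.mp hb' with hb' | rfl
      · exact Or.inl (inr_inr_mem_stageRows.mpr ⟨hbb, hb'⟩)
      · exact Or.inr (Or.inr ⟨⟨b, hbb⟩, rfl⟩)
  have hι₁_not_fixed : ∀ j', ((ι₁ j' : ↥(stageRows i (n + 1))) : RowLabel) ∉ stageRows i n := by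
    intro j' hmem
    exact lt_irrefl n (inr_inl_mem_stageRows.mp hmem).2
  have hι₂_not_fixed : ∀ b, ((ι₂ b : ↥(stageRows i (n + 1))) : RowLabel) ∉ stageRows i n := by
    intro b hmem
    exact lt_irrefl n (inr_inr_mem_stageRows.mp hmem).2
  have hι₂val : ∀ b, ((ι₂ b : ↥(stageRows i (n + 1))) : RowLabel) = Sum.inr (Sum.inr ((b : ℕ), n)) :=
    fun b => rfl
  have hι₂_not_range : ∀ b, ι₂ b ∉ Set.range ι₁ := by
    rintro b ⟨j, e⟩
    have := congrArg Subtype.val e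
    simp [hι₁, hι₂] at this
  have hfixed_not_range : ∀ x : ↥(stageRows i (n + 1)), (x : RowLabel) ∈ stageRows i n →
      x ∉ Set.range ι₁ := by
    rintro x hx ⟨j, rfl⟩
    exact hι₁_not_fixed j hx
  -- the reduced rows and their closed forms
  set V2 : ↥(stageRows i (n + 1)) → Fin r → Polynomial (MvPolynomial (Fin h) ℂ) :=
    fun x => reducedRow r i n (nodeY h) (x : RowLabel) with hV2def
  have hV2fixed : ∀ x : ↥(stageRows i (n + 1)), (x : RowLabel) ∈ stageRows i n →
      V2 x = fun col => Polynomial.C (rowVec r (nodeY h) (x : RowLabel) col) :=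
    fun x hx => reducedRow_of_mem r i n (nodeY h) _ hx
  have hV2α : ∀ j' : Fin i, V2 (ι₁ j') = fun col : Fin r =>
      if (col : ℕ) < windowStart i then 0 else
        Polynomial.C ((inclFactorial (j' : ℕ) (col : ℕ) : MvPolynomial (Fin h) ℂ)) *
          Polynomial.X ^ (col : ℕ) := fun j' => reducedRow_alpha r i n (nodeY h) (j' : ℕ)
  have hV2β : ∀ b : Fin n, V2 (ι₂ b) = fun col : Fin r =>
      ∑ d ∈ (bits (col : ℕ)).powerset.filter (fun d => i ≤ bin d),
        Polynomial.C ((((bits (col : ℕ)) \ d).card.factorial : MvPolynomial (Fin h) ℂ) *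
          nodeY h (b : ℕ) ^ bin (bits (col : ℕ) \ d) * (d.card.factorial : MvPolynomial (Fin h) ℂ)) *
          Polynomial.X ^ bin d := fun b => reducedRow_beta r i n (nodeY h) (b : ℕ)
  show LinearIndependent (Polynomial (MvPolynomial (Fin h) ℂ)) V2
  -- STEP 3: recombine the attached rows of the peeled point by `G_i⁻¹`
  set Gc : Matrix (Fin i) (Fin i) ℂ := (peelMatrix i).map (Int.castRingHom ℂ) with hGc
  have hGdet : IsUnit Gc.det := by
    rw [isUnit_iff_ne_zero]
    intro h0
    apply hG
    have e0 : (Int.castRingHom ℂ) (peelMatrix i).det = 0 := by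
      rw [RingHom.map_det, RingHom.mapMatrix_apply, ← hGc]
      exact h0
    rw [eq_intCast] at e0
    exact Int.cast_eq_zero.mp e0
  obtain ⟨V3, hV3⟩ : ∃ V3 : ↥(stageRows i (n + 1)) → Fin (r) →
      Polynomial (MvPolynomial (Fin h) ℂ), ∀ x, V3 x =
      if hx : ∃ j', ι₁ j' = x then
        ∑ j, (algebraMap ℂ (Polynomial (MvPolynomial (Fin h) ℂ)) (Gc⁻¹ (Classical.choose hx) j)) •
          V2 (ι₁ j)
      else V2 x := ⟨_, fun _ => rfl⟩
  have hV3α : ∀ j', V3 (ι₁ j') =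
      ∑ j, (algebraMap ℂ (Polynomial (MvPolynomial (Fin h) ℂ)) (Gc⁻¹ j' j)) • V2 (ι₁ j) := by
    intro j'
    have hx : ∃ j, ι₁ j = ι₁ j' := ⟨j', rfl⟩
    rw [hV3, dif_pos hx, hι₁inj (Classical.choose_spec hx)]
  have hV3off : ∀ x, x ∉ Set.range ι₁ → V3 x = V2 x := fun x hx => by
    rw [hV3, dif_neg (fun ⟨j, e⟩ => hx ⟨j, e⟩)]
  apply linearIndependent_of_block V2 V3 ι₁ hι₁inj
    (Gc⁻¹.map (algebraMap ℂ (Polynomial (MvPolynomial (Fin h) ℂ))))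
    (Gc.map (algebraMap ℂ (Polynomial (MvPolynomial (Fin h) ℂ)))) 1
    (fun x hx => by rwa [one_mul] at hx)
    (by rw [← Matrix.map_mul, Matrix.mul_nonsing_inv Gc hGdet,
      Matrix.map_one _ (map_zero _) (map_one _), one_smul])
    (fun j' => by rw [hV3α]; rfl) hV3off
  -- closed form of the recombined attached rows
  have hκ : ∀ (j' : Fin i) (col : Fin (r)), V3 (ι₁ j') col =
      if (col : ℕ) < windowStart i then 0 else
        Polynomial.C (MvPolynomial.C (∑ j : Fin i, Gc⁻¹ j' j * (inclFactorial (j : ℕ) (col : ℕ) : ℂ))) *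
          Polynomial.X ^ (col : ℕ) := by
    intro j' col
    rw [hV3α, Finset.sum_apply]
    simp only [Pi.smul_apply, hV2α, smul_eq_mul]
    split_ifs with hlt
    · simp
    · rw [map_sum, map_sum, Finset.sum_mul]
      refine Finset.sum_congr rfl fun j _ => ?_
      rw [Polynomial.algebraMap_apply, MvPolynomial.algebraMap_eq]
      simp only [map_mul, map_natCast]
      ring
  -- STEP 4: the leading coefficients
  obtain ⟨w, hw⟩ : ∃ w : ↥(stageRows i (n + 1)) → ℕ, ∀ x, w x =
      Sum.elim (fun _ => 0) (Sum.elim (fun jb : ℕ × ℕ => if jb.2 = n then windowStart i + jb.1 else 0)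
        (fun bb : ℕ × ℕ => if bb.2 = n then i else 0)) (x : RowLabel) := ⟨_, fun _ => rfl⟩
  have hwfixed : ∀ x : ↥(stageRows i (n + 1)), (x : RowLabel) ∈ stageRows i n → w x = 0 := by
    rintro ⟨x, hx'⟩ hx
    rw [hw]
    rcases x with m | ⟨j, b⟩ | ⟨b, b'⟩
    · rfl
    · have hb : b ≠ n := ne_of_lt (inr_inl_mem_stageRows.mp hx).2
      simp [hb]
    · have hb : b' ≠ n := ne_of_lt (inr_inr_mem_stageRows.mp hx).2
      simp [hb]
  have hwα : ∀ j', w (ι₁ j') = windowStart i + (j' : ℕ) := fun j' => by rw [hw]; simp [hι₁]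
  have hwβ : ∀ b, w (ι₂ b) = i := fun b => by rw [hw]; simp [hι₂]
  have hV3fixed : ∀ x : ↥(stageRows i (n + 1)), (x : RowLabel) ∈ stageRows i n →
      V3 x = fun col => Polynomial.C (rowVec (r) (nodeY h) (x : RowLabel) col) :=
    fun x hx => by rw [hV3off x (hfixed_not_range x hx), hV2fixed x hx]
  have hV3β := fun b => (hV3off _ (hι₂_not_range b)).trans (hV2β b)
  -- the relabelling into stage `(i+1, n)` and the scalars
  obtain ⟨φ, hφ⟩ : ∃ φ : ↥(stageRows i (n + 1)) → RowLabel, ∀ x, φ x =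
      Sum.elim (fun m => (Sum.inl m : RowLabel))
        (Sum.elim (fun jb : ℕ × ℕ => if jb.2 = n then Sum.inl (windowStart i + jb.1) else Sum.inr (Sum.inl jb))
          (fun bb : ℕ × ℕ => if bb.2 = n then Sum.inr (Sum.inl (i, bb.1)) else Sum.inr (Sum.inr bb)))
        (x : RowLabel) := ⟨_, fun _ => rfl⟩
  have hφfixed : ∀ x : ↥(stageRows i (n + 1)), (x : RowLabel) ∈ stageRows i n → φ x = x := by
    rintro ⟨x, hx'⟩ hx
    rw [hφ]
    rcases x with m | ⟨j, b⟩ | ⟨b, b'⟩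
    · rfl
    · have hb : b ≠ n := ne_of_lt (inr_inl_mem_stageRows.mp hx).2
      simp [hb]
    · have hb : b' ≠ n := ne_of_lt (inr_inr_mem_stageRows.mp hx).2
      simp [hb]
  have hφα : ∀ j', φ (ι₁ j') = Sum.inl (windowStart i + (j' : ℕ)) := fun j' => by
    rw [hφ]; simp [hι₁]
  have hφβ : ∀ b, φ (ι₂ b) = Sum.inr (Sum.inl (i, (b : ℕ))) := fun b => by rw [hφ]; simp [hι₂]
  have hφmem : ∀ x, φ x ∈ stageRows (i + 1) n := by
    intro x
    rcases htri x with hx | ⟨j', rfl⟩ | ⟨b, rfl⟩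
    · rw [hφfixed x hx]
      obtain ⟨y, hy⟩ := x
      rcases y with m | ⟨j, b⟩ | ⟨b, b'⟩
      · have := inl_mem_stageRows.mp hx
        rw [inl_mem_stageRows, windowStart_succ]
        omega
      · have := inr_inl_mem_stageRows.mp hx
        exact inr_inl_mem_stageRows.mpr ⟨Nat.lt_succ_of_lt this.1, this.2⟩
      · exact inr_inr_mem_stageRows.mpr (inr_inr_mem_stageRows.mp hx)
    · rw [hφα, inl_mem_stageRows, windowStart_succ]
      have := j'.2
      omega
    · rw [hφβ, inr_inl_mem_stageRows]
      exact ⟨Nat.lt_succ_self i, b.2⟩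
  have hφinj : Function.Injective φ := by
    intro x y exy
    rcases htri x with hx | ⟨j', rfl⟩ | ⟨b, rfl⟩ <;>
      rcases htri y with hy | ⟨j'', rfl⟩ | ⟨b', rfl⟩
    · rw [hφfixed x hx, hφfixed y hy] at exy
      exact Subtype.ext exy
    · rw [hφfixed x hx, hφα] at exy
      rw [exy, inl_mem_stageRows] at hx
      omega
    · rw [hφfixed x hx, hφβ] at exy
      rw [exy, inr_inl_mem_stageRows] at hx
      omega
    · rw [hφfixed y hy, hφα] at exy
      rw [← exy, inl_mem_stageRows] at hy
      omega
    · rw [hφα, hφα] at exy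
      simp only [Sum.inl.injEq, add_right_inj] at exy
      rw [Fin.ext exy]
    · rw [hφα, hφβ] at exy
      exact absurd exy (by simp)
    · rw [hφfixed y hy, hφβ] at exy
      rw [← exy, inr_inl_mem_stageRows] at hy
      omega
    · rw [hφβ, hφα] at exy
      exact absurd exy (by simp)
    · rw [hφβ, hφβ] at exy
      simp only [Sum.inr.injEq, Sum.inl.injEq, Prod.mk.injEq, true_and] at exy
      rw [Fin.ext exy]
  obtain ⟨s, hs⟩ : ∃ s : ↥(stageRows i (n + 1)) → MvPolynomial (Fin h) ℂ, ∀ x, s x =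
      Sum.elim (fun _ => (1 : MvPolynomial (Fin h) ℂ)) (Sum.elim (fun _ => 1)
        (fun bb : ℕ × ℕ => if bb.2 = n then ((bits i).card.factorial : MvPolynomial (Fin h) ℂ) else 1))
        (x : RowLabel) := ⟨_, fun _ => rfl⟩
  have hsne : ∀ x, s x ≠ 0 := by
    intro x
    rw [hs]
    obtain ⟨y, hy⟩ := x
    rcases y with m | ⟨j, b⟩ | ⟨b, b'⟩
    · exact one_ne_zero
    · exact one_ne_zero
    · simp only [Sum.elim_inr]
      split_ifs
      · rw [← map_natCast (MvPolynomial.C : ℂ →+* MvPolynomial (Fin h) ℂ), Ne,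
          MvPolynomial.C_eq_zero]
        exact_mod_cast Nat.factorial_ne_zero _
      · exact one_ne_zero
  have hsreg : ∀ x y, s x * y = 0 → y = 0 := fun x y hxy =>
    (mul_eq_zero.mp hxy).resolve_left (hsne x)
  -- the leading-coefficient criterion
  apply linearIndependent_of_coeff V3 w
  · -- vanishing below the leading degree
    intro x col d hd
    rcases htri x with hx | ⟨j', rfl⟩ | ⟨b, rfl⟩
    · rw [hwfixed x hx] at hd
      exact absurd hd (Nat.not_lt_zero d)
    · rw [hwα] at hd
      rw [hκ]
      split_ifs with hlt
      · exact Polynomial.coeff_zero d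
      · rw [Polynomial.coeff_C_mul_X_pow]
        split_ifs with hdc
        · -- `d = col` lies in the window strictly left of column `c_i + j'`
          obtain ⟨m, hm⟩ : ∃ m : Fin i, (col : ℕ) = windowStart i + (m : ℕ) :=
            ⟨⟨(col : ℕ) - windowStart i, by omega⟩, by simp; omega⟩
          have hne : j' ≠ m := fun e => by rw [e] at hd; omega
          rw [hm, peelMatrix_inv_mul_window i hG j' m, if_neg hne, map_zero]
        · rfl
    · rw [hwβ] at hd
      rw [hV3β, coeff_sum_C_mul_X_pow_bin, if_neg]
      rw [Finset.mem_filter, bin_bits]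
      omega
  · -- the leading coefficient vectors are (up to units) the rows alive at stage `(i+1, n)`
    have hL : (fun (x : ↥(stageRows i (n + 1))) (col : Fin (r)) =>
        (V3 x col).coeff (w x)) =
        fun x => s x • (fun col => rowVec (r) (nodeY h) (φ x) col) := by
      funext x
      funext col
      simp only [Pi.smul_apply, smul_eq_mul]
      rcases htri x with hx | ⟨j', rfl⟩ | ⟨b, rfl⟩
      · rw [hwfixed x hx, hV3fixed x hx, Polynomial.coeff_C_zero, hφfixed x hx, hs]
        obtain ⟨y, hy⟩ := x
        rcases y with m | ⟨j, b⟩ | ⟨b, b'⟩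
        · simp
        · simp
        · have hb : b' ≠ n := ne_of_lt (inr_inr_mem_stageRows.mp hx).2
          simp [hb]
      · rw [hwα, hκ, hφα, hs]
        simp only [hι₁, Sum.elim_inr, Sum.elim_inl, one_mul, rowVec]
        split_ifs with hlt h1 h2
        · exfalso; omega
        · exact Polynomial.coeff_zero _
        · rw [Polynomial.coeff_C_mul_X_pow, if_pos h2.symm, h2,
            show windowStart i + (j' : ℕ) = windowStart i + ((j' : Fin i) : ℕ) from rfl,
            peelMatrix_inv_mul_window i hG j' j', if_pos rfl, map_one]
        · rw [Polynomial.coeff_C_mul_X_pow, if_neg (fun e => h2 e.symm)]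
      · rw [hwβ, hV3β, hφβ, hs, coeff_sum_C_mul_X_pow_bin]
        simp only [hι₂, Sum.elim_inr, if_true, Finset.mem_filter, Finset.mem_powerset, bin_bits,
          le_refl, and_true, rowVec]
        split_ifs with hsub
        · rw [Finset.card_sdiff_of_subset hsub]
          ring
        · rw [mul_zero]
    rw [hL]
    exact linearIndependent_smul_of_regular _ s hsreg
      (linearIndependent_comp_subtype (stageRows (i + 1) n) (rowVec (r) (nodeY h))
        φ hφmem hφinj IH)


end Summit.ValiantsHypothesis.ValiantsHypothesis.Theorems.BarrierLever.MoorePeel
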